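import Mathlib
import Summits.Ventures.Crystal3D.Theorems.StickyWulffConstantLayerChainDefs
import Summits.Ventures.Crystal3D.Theorems.StickyWulffConstantStackingLiminfSliceArea
import Summits.Ventures.Crystal3D.Theorems.StickyWulffConstantStackingLiminfSliceOuter
import Summits.Ventures.Crystal3D.Theorems.StickyWulffConstantStackingLiminfSliceInner
import HarnessLib

/-!
# SLICE DOMINATION (stub `stub_sliceDomination` of line `LayerChain`, crux `StackingLiminf`,
# stmt-Ventures-19145): every horizontal section of `W_f` is at least as large as that of `W_0`

Route `StickyWulffConstant` of the venture `Summits/Ventures/Crystal3D` (cell `crystal3d-full`).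
STEP 2 of the planner's line `LayerChain` (cf-p1 gen 10, `LayerChain.lean` v3), statement
`SliceDomination` VERBATIM over the landed vocabulary `StickyWulffConstantLayerChainDefs`
(p473239): `∀ f ∈ [0,1], ∀ y, volume (stackSlice 0 y) ≤ volume (stackSlice f y)`.

Proof = cf-p2 R19's blueprint (`BLUEPRINT-sliceDomination.md`, kit j257743 / j257744), kernel
version: write `y = √(2/3)·Z`; for `|Z| > 3` the `W_0`-section is empty (cap facets); on each
chamber `|Z| ≤ 1`, `1 ≤ Z ≤ 3`, `−3 ≤ Z ≤ −1` the `W_0`-section lies in an explicit tent window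
`T_0(Z)` (six facet certificates, `…SliceOuter`), the `W_f`-section contains an explicit tent
window `T_f(Z)` (six vertex certificates + convexity, `…SliceInner`, `…SliceHull`), both windows
have exactly computable areas (`volume_tentWindow`, `…SliceArea`), and
`A_f − A_0 = 2f(1−f)·e(Z) ≥ 0` with `e = Z²` resp. `(3−|Z|)²/4` (scaled).  Equality at `Z = 0`,
`|Z| = 3`, `f ∈ {0,1}` is not claimed here.
WHAT THIS IS NOT: the chimera step, the volume law `|W_f| = 4√2(16 + f(1−f))`, or anything about
clusters; rung F-C1 not moved.
-/

noncomputable section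

namespace Summit.Ventures.Crystal3D.Theorems

open MeasureTheory Set
open Summit.Ventures.Crystal3D.LayerChain

/-- Slice domination at height `√(2/3)·Z`, chamber `|Z| ≤ 1`. -/
theorem volume_stackSlice_zero_le_mid (f Z : ℝ) (hf0 : 0 ≤ f) (hf1 : f ≤ 1) (hZ1 : -1 ≤ Z)
    (hZ2 : Z ≤ 1) :
    volume (stackSlice 0 (Real.sqrt (2 / 3) * Z)) ≤ volume (stackSlice f (Real.sqrt (2 / 3) * Z)) := by
  have h3 : Real.sqrt 3 * Real.sqrt 3 = 3 := Real.mul_self_sqrt (by norm_num)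
  have hs : 0 < Real.sqrt 3 := Real.sqrt_pos.2 (by norm_num)
  have hw1 : -1 ≤ (1 - 2 * f) * Z := by nlinarith
  have hw2 : (1 - 2 * f) * Z ≤ 1 := by nlinarith
  calc volume (stackSlice 0 (Real.sqrt (2 / 3) * Z))
      ≤ volume {p : ℝ × ℝ | Real.sqrt 3 * (-3 / 2 + Z / 6) ≤ p.2 ∧
          p.2 ≤ Real.sqrt 3 * (3 / 2 + Z / 6) ∧
          |p.1| ≤ 3 - Real.sqrt 3 / 3 * |p.2 - Real.sqrt 3 * (-(Z / 3))|} :=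
        measure_mono (stackSlice_zero_subset_mid Z)
    _ = ENNReal.ofReal (2 * 3 * (Real.sqrt 3 * (3 / 2 + Z / 6) - Real.sqrt 3 * (-3 / 2 + Z / 6)) -
          Real.sqrt 3 / 3 * ((Real.sqrt 3 * (-(Z / 3)) - Real.sqrt 3 * (-3 / 2 + Z / 6)) ^ 2 +
            (Real.sqrt 3 * (3 / 2 + Z / 6) - Real.sqrt 3 * (-(Z / 3))) ^ 2)) :=
        volume_tentWindow _ _ _ _ _ (by nlinarith) (by nlinarith) (by positivity)
          (by nlinarith) (by nlinarith)
    _ ≤ ENNReal.ofReal (2 * 3 * (Real.sqrt 3 * (3 / 2 + (1 - 2 * f) * Z / 6) -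
            Real.sqrt 3 * (-3 / 2 + (1 - 2 * f) * Z / 6)) -
          Real.sqrt 3 / 3 *
            ((Real.sqrt 3 * (-((1 - 2 * f) * Z / 3)) - Real.sqrt 3 * (-3 / 2 + (1 - 2 * f) * Z / 6)) ^ 2 +
              (Real.sqrt 3 * (3 / 2 + (1 - 2 * f) * Z / 6) - Real.sqrt 3 * (-((1 - 2 * f) * Z / 3))) ^ 2)) := by
        apply ENNReal.ofReal_le_ofReal
        have hf : 0 ≤ f * (1 - f) := mul_nonneg hf0 (by linarith)
        nlinarith [h3, hs, sq_nonneg Z, mul_nonneg hf (sq_nonneg Z)]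
    _ = volume {p : ℝ × ℝ | Real.sqrt 3 * (-3 / 2 + (1 - 2 * f) * Z / 6) ≤ p.2 ∧
          p.2 ≤ Real.sqrt 3 * (3 / 2 + (1 - 2 * f) * Z / 6) ∧
          |p.1| ≤ 3 - Real.sqrt 3 / 3 * |p.2 - Real.sqrt 3 * (-((1 - 2 * f) * Z / 3))|} :=
        (volume_tentWindow _ _ _ _ _ (by nlinarith) (by nlinarith) (by positivity)
          (by nlinarith) (by nlinarith)).symm
    _ ≤ volume (stackSlice f (Real.sqrt (2 / 3) * Z)) :=
        measure_mono (tentWindow_subset_stackSlice_mid f Z hf0 hf1 hZ1 hZ2)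

/-- Slice domination at height `√(2/3)·Z`, chamber `1 ≤ Z ≤ 3`. -/
theorem volume_stackSlice_zero_le_top (f Z : ℝ) (hf0 : 0 ≤ f) (hf1 : f ≤ 1) (hZ1 : 1 ≤ Z)
    (hZ2 : Z ≤ 3) :
    volume (stackSlice 0 (Real.sqrt (2 / 3) * Z)) ≤ volume (stackSlice f (Real.sqrt (2 / 3) * Z)) := by
  have h3 : Real.sqrt 3 * Real.sqrt 3 = 3 := Real.mul_self_sqrt (by norm_num)
  have hs : 0 < Real.sqrt 3 := Real.sqrt_pos.2 (by norm_num)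
  have hg0 : 0 ≤ f * (3 - Z) := mul_nonneg hf0 (by linarith)
  have hgs : f * (3 - Z) ≤ 3 - Z := by nlinarith
  calc volume (stackSlice 0 (Real.sqrt (2 / 3) * Z))
      ≤ volume {p : ℝ × ℝ | Real.sqrt 3 * (-3 / 2 + Z / 6) ≤ p.2 ∧
          p.2 ≤ Real.sqrt 3 * (2 - Z / 3) ∧
          |p.1| ≤ (7 / 2 - Z / 2) - Real.sqrt 3 / 3 * |p.2 - Real.sqrt 3 * (-1 / 2 + Z / 6)|} :=
        measure_mono (stackSlice_zero_subset_top Z)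
    _ = ENNReal.ofReal (2 * (7 / 2 - Z / 2) * (Real.sqrt 3 * (2 - Z / 3) - Real.sqrt 3 * (-3 / 2 + Z / 6)) -
          Real.sqrt 3 / 3 * ((Real.sqrt 3 * (-1 / 2 + Z / 6) - Real.sqrt 3 * (-3 / 2 + Z / 6)) ^ 2 +
            (Real.sqrt 3 * (2 - Z / 3) - Real.sqrt 3 * (-1 / 2 + Z / 6)) ^ 2)) :=
        volume_tentWindow _ _ _ _ _ (by nlinarith) (by nlinarith) (by positivity)
          (by nlinarith) (by nlinarith)
    _ ≤ ENNReal.ofReal (2 * (2 + (3 - Z) / 2) *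
            (Real.sqrt 3 * (1 + (3 - Z) / 3 - f * (3 - Z) / 6) -
              Real.sqrt 3 * (-1 - (3 - Z) / 6 - f * (3 - Z) / 6)) -
          Real.sqrt 3 / 3 *
            ((Real.sqrt 3 * (-((3 - Z) / 6) + f * (3 - Z) / 3) -
                Real.sqrt 3 * (-1 - (3 - Z) / 6 - f * (3 - Z) / 6)) ^ 2 +
              (Real.sqrt 3 * (1 + (3 - Z) / 3 - f * (3 - Z) / 6) -
                Real.sqrt 3 * (-((3 - Z) / 6) + f * (3 - Z) / 3)) ^ 2)) := by
        apply ENNReal.ofReal_le_ofReal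
        nlinarith [h3, hs, mul_nonneg hg0 (sub_nonneg.2 hgs)]
    _ = volume {p : ℝ × ℝ | Real.sqrt 3 * (-1 - (3 - Z) / 6 - f * (3 - Z) / 6) ≤ p.2 ∧
          p.2 ≤ Real.sqrt 3 * (1 + (3 - Z) / 3 - f * (3 - Z) / 6) ∧
          |p.1| ≤ (2 + (3 - Z) / 2) -
            Real.sqrt 3 / 3 * |p.2 - Real.sqrt 3 * (-((3 - Z) / 6) + f * (3 - Z) / 3)|} :=
        (volume_tentWindow _ _ _ _ _ (by nlinarith) (by nlinarith) (by positivity)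
          (by nlinarith) (by nlinarith)).symm
    _ ≤ volume (stackSlice f (Real.sqrt (2 / 3) * Z)) :=
        measure_mono (tentWindow_subset_stackSlice_top f Z hf0 hf1 hZ1 hZ2)

/-- Slice domination at height `√(2/3)·Z`, chamber `−3 ≤ Z ≤ −1`. -/
theorem volume_stackSlice_zero_le_bot (f Z : ℝ) (hf0 : 0 ≤ f) (hf1 : f ≤ 1) (hZ1 : -3 ≤ Z)
    (hZ2 : Z ≤ -1) :
    volume (stackSlice 0 (Real.sqrt (2 / 3) * Z)) ≤ volume (stackSlice f (Real.sqrt (2 / 3) * Z)) := by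
  have h3 : Real.sqrt 3 * Real.sqrt 3 = 3 := Real.mul_self_sqrt (by norm_num)
  have hs : 0 < Real.sqrt 3 := Real.sqrt_pos.2 (by norm_num)
  have hg0 : 0 ≤ f * (3 + Z) := mul_nonneg hf0 (by linarith)
  have hgs : f * (3 + Z) ≤ 3 + Z := by nlinarith
  calc volume (stackSlice 0 (Real.sqrt (2 / 3) * Z))
      ≤ volume {p : ℝ × ℝ | Real.sqrt 3 * (-2 - Z / 3) ≤ p.2 ∧
          p.2 ≤ Real.sqrt 3 * (3 / 2 + Z / 6) ∧
          |p.1| ≤ (7 / 2 + Z / 2) - Real.sqrt 3 / 3 * |p.2 - Real.sqrt 3 * (1 / 2 + Z / 6)|} :=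
        measure_mono (stackSlice_zero_subset_bot Z)
    _ = ENNReal.ofReal (2 * (7 / 2 + Z / 2) * (Real.sqrt 3 * (3 / 2 + Z / 6) - Real.sqrt 3 * (-2 - Z / 3)) -
          Real.sqrt 3 / 3 * ((Real.sqrt 3 * (1 / 2 + Z / 6) - Real.sqrt 3 * (-2 - Z / 3)) ^ 2 +
            (Real.sqrt 3 * (3 / 2 + Z / 6) - Real.sqrt 3 * (1 / 2 + Z / 6)) ^ 2)) :=
        volume_tentWindow _ _ _ _ _ (by nlinarith) (by nlinarith) (by positivity)
          (by nlinarith) (by nlinarith)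
    _ ≤ ENNReal.ofReal (2 * (2 + (3 + Z) / 2) *
            (Real.sqrt 3 * (1 + (3 + Z) / 6 + f * (3 + Z) / 6) -
              Real.sqrt 3 * (-1 - (3 + Z) / 3 + f * (3 + Z) / 6)) -
          Real.sqrt 3 / 3 *
            ((Real.sqrt 3 * ((3 + Z) / 6 - f * (3 + Z) / 3) -
                Real.sqrt 3 * (-1 - (3 + Z) / 3 + f * (3 + Z) / 6)) ^ 2 +
              (Real.sqrt 3 * (1 + (3 + Z) / 6 + f * (3 + Z) / 6) -
                Real.sqrt 3 * ((3 + Z) / 6 - f * (3 + Z) / 3)) ^ 2)) := by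
        apply ENNReal.ofReal_le_ofReal
        nlinarith [h3, hs, mul_nonneg hg0 (sub_nonneg.2 hgs)]
    _ = volume {p : ℝ × ℝ | Real.sqrt 3 * (-1 - (3 + Z) / 3 + f * (3 + Z) / 6) ≤ p.2 ∧
          p.2 ≤ Real.sqrt 3 * (1 + (3 + Z) / 6 + f * (3 + Z) / 6) ∧
          |p.1| ≤ (2 + (3 + Z) / 2) -
            Real.sqrt 3 / 3 * |p.2 - Real.sqrt 3 * ((3 + Z) / 6 - f * (3 + Z) / 3)|} :=
        (volume_tentWindow _ _ _ _ _ (by nlinarith) (by nlinarith) (by positivity)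
          (by nlinarith) (by nlinarith)).symm
    _ ≤ volume (stackSlice f (Real.sqrt (2 / 3) * Z)) :=
        measure_mono (tentWindow_subset_stackSlice_bot f Z hf0 hf1 hZ1 hZ2)

/-- **Stub `stub_sliceDomination` (STEP 2 of line `LayerChain`; statement = `SliceDomination` of
`LayerChain.lean` v3 verbatim over the landed vocabulary `StickyWulffConstantLayerChainDefs`).**
Every horizontal section of the homogenised stacking Wulff body `W_f`, `f ∈ [0,1]`, has at least
the area of the section of the truncated octahedron `W_0` at the same height. -/
theorem stub_sliceDomination :
    ∀ f : ℝ, 0 ≤ f → f ≤ 1 → ∀ y : ℝ,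
      MeasureTheory.volume (stackSlice 0 y) ≤ MeasureTheory.volume (stackSlice f y) := by
  intro f hf0 hf1 y
  have hh : Real.sqrt (2 / 3) ≠ 0 := (Real.sqrt_pos.2 (by norm_num)).ne'
  obtain ⟨Z, rfl⟩ : ∃ Z, y = Real.sqrt (2 / 3) * Z := ⟨y / Real.sqrt (2 / 3), by field_simp⟩
  by_cases hZ3 : 3 < |Z|
  · rw [stackSlice_zero_eq_empty hZ3, measure_empty]; exact bot_le
  have hZ := abs_le.1 (not_lt.1 hZ3)
  rcases le_total Z (-1) with h1 | h1
  · exact volume_stackSlice_zero_le_bot f Z hf0 hf1 hZ.1 h1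
  rcases le_total Z 1 with h2 | h2
  · exact volume_stackSlice_zero_le_mid f Z hf0 hf1 h1 h2
  · exact volume_stackSlice_zero_le_top f Z hf0 hf1 h2 hZ.2

end Summit.Ventures.Crystal3D.Theorems

end
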